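import Summits.AnomalousDissipation.AnomalousDissipation.Theorems.SawtoothPulseCascadeK1LocalisedCascadeClassBlocksOsc
import Summits.AnomalousDissipation.AnomalousDissipation.Theorems.SawtoothPulseCascadeK1LocalisedCascadeStripBlocks

/-!
# STRIP CLASSES THROUGH ONE HALF-STEP, SUMMED OVER FIBRE BLOCKS — OSCILLATORY GRADE

(S-B/S-C assembly seat; the LEDGER ASSEMBLY, layer L3, Osc grade.)  This is `…StripBlocks` VERBATIM over the oscillatory
multi-block steps `…ClassBlocksOsc.tsum_class_{v,h}step_blocks_osc_le`: low fibres `< Λ₀` pass exactly, chopped fibres in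
blocks `[Λ_m, Λ_{m+1})` with plateaux `K + Q₂^m`, cut-off kernels `(Q₁^m+Q₂^m)/(Q₂^m−Q₁^m)`, input kernels
`A_m = (K+Q₂^m+Λ_mG)/(Λ_mG−K−Q₂^m)`, block denominators `≥ D_m = Λ_mG − K − Q₂^m`, and the oscillatory per-block scalar
hypotheses `1/(2πD_m) + 4MPδ_j/(πD_m d₀^m) ≤ A_m d₀^m`, `A_m·2π(Λ_{m+1}G)e^{−M²/2}/(2N_j) + 2N_j/(πD_m) ≤ ε₀^m`.

* `tsum_strip_vstep_blocks_osc_le` (S-V), `tsum_lowFibre_hstep_blocks_osc_le` (T-H).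

No definitions; no statement about the crux.
-/

-- `Summit.<Summit>.<Problem>`: single-conjunct summit, the duplicate namespace segment is deliberate.
set_option linter.dupNamespace false

noncomputable section

namespace Summit.AnomalousDissipation.AnomalousDissipation.Theorems.SawtoothPulseCascade.K1Window

open MeasureTheory Set Filter Topology UnitAddTorus Function Complex Metric
open scoped Real ENNReal
open Literature.Analysis Literature.Analysis.FunctionSpaces Literature.Analysis.FunctionSpaces.Torus Literature.Analysis.FluidPDE
open Literature.Analysis.FluidPDE.ShearStage
open Literature.Analysis.FluidPDE.SawtoothCascade Literature.Analysis.FluidPDE.SawtoothCascade.CascadeParams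
open Summit.AnomalousDissipation.AnomalousDissipation.Theorems.SawtoothPulseCascade.K1Start
open Summit.AnomalousDissipation.AnomalousDissipation.Theorems.SawtoothPulseCascade.K1Flat
open Summit.AnomalousDissipation.AnomalousDissipation.Theorems.SawtoothPulseCascade.K1Ledger.From

section Cascade

variable (P : CascadeParams)

/-! ## §1 (S-V): the strip of `a_{j+1}` -/

/-- **THE STRIP OF `a_{j+1}` THROUGH THE V HALF-STEP, SUMMED OVER FIBRE BLOCKS** (S-V; see the file header).
[cite: Grafakos2014, Prop. 3.1.2 (5), Prop. 3.2.7 (3), §3.1.3] -/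
theorem tsum_strip_vstep_blocks_osc_le {G : ℕ} (hγ : P.γ = G) (hδ₀ : 0 < P.δ₀) (hd : 0 < P.d) (hN₀ : 1 ≤ P.N₀)
    (hρN : 1 ≤ P.ρN) (a b : ℕ → UnitAddTorus (Fin 2) → ℝ) (has : ∀ j, IsSmooth (a j)) (h0 : a 0 = datum)
    (hb : ∀ j, b j = a j ∘ shearMap 0 1 (amp ⟨P.U j, P.U_periodic j, P.contDiff_U (P.δ_pos hδ₀ hd j)⟩ P.γ))
    (hab : ∀ j, a (j + 1) = b j ∘ shearMap 1 0 (amp ⟨P.U j, P.U_periodic j, P.contDiff_U (P.δ_pos hδ₀ hd j)⟩ P.γ))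
    (j : ℕ) (K : ℕ) (Λb : ℕ → ℕ) (hΛb : Monotone Λb) (hΛ0 : 1 ≤ Λb 0) (Mb : ℕ)
    (Q₁ Q₂ : ℕ → ℕ) (hQ : ∀ m, Q₁ m < Q₂ m) (hΛQ : ∀ m, K + Q₂ m < Λb m * G)
    {M : ℝ} (hM : 1 ≤ M) (hMδ : M * P.δ j < π / 2)
    (d₀ ε₀ : ℕ → ℝ) (hd₀ : ∀ m, 0 < d₀ m) (hMd : ∀ m, M * P.δ j < π * P.N j * d₀ m)
    (hAd : ∀ m, 1 / (2 * π * (((Λb m * G : ℕ) : ℝ) - ((K + Q₂ m : ℕ) : ℝ))) +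
        4 * M * P.δ j / (π * (((Λb m * G : ℕ) : ℝ) - ((K + Q₂ m : ℕ) : ℝ)) * d₀ m) ≤
      (((K + Q₂ m : ℕ) : ℝ) + ((Λb m * G : ℕ) : ℝ)) / (((Λb m * G : ℕ) : ℝ) - ((K + Q₂ m : ℕ) : ℝ)) * d₀ m)
    (hε0 : ∀ m, 0 ≤ ε₀ m)
    (hε : ∀ m, (((K + Q₂ m : ℕ) : ℝ) + ((Λb m * G : ℕ) : ℝ)) / (((Λb m * G : ℕ) : ℝ) - ((K + Q₂ m : ℕ) : ℝ)) *
      (2 * π * ((Λb (m + 1) * G : ℕ) : ℝ) * (Real.exp (-(M ^ 2 / 2)) / (2 * P.N j))) +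
      2 * P.N j / (π * (((Λb m * G : ℕ) : ℝ) - ((K + Q₂ m : ℕ) : ℝ))) ≤ ε₀ m)
    {u' v' Y : ℕ} (hfeed : ∀ m, u' * Λb (m + 1) ≤ v' * (Q₁ m + 1)) (hY : ∀ m, Y ≤ Q₁ m + 1) :
    ∑' k : Fin 2 → ℤ, (if |k 0| < (K : ℤ) then (1 : ℝ) else 0) * ‖mFourierCoeff (fun x => (a (j + 1) x : ℂ)) k‖ ^ 2 ≤
      ∑' k : Fin 2 → ℤ, (if |k 1| < (Λb 0 : ℤ) then (1 : ℝ) else 0) * ‖mFourierCoeff (fun x => (b j x : ℂ)) k‖ ^ 2 +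
      ((Real.sqrt (∑ m ∈ Finset.range Mb, ((((Q₁ m : ℝ) + Q₂ m) / ((Q₂ m : ℝ) - Q₁ m)) *
            (ε₀ m + (((K + Q₂ m : ℕ) : ℝ) + ((Λb m * G : ℕ) : ℝ)) / (((Λb m * G : ℕ) : ℝ) - ((K + Q₂ m : ℕ) : ℝ)) *
              Real.sqrt ((2 * P.N j : ℕ) * (4 * d₀ m)))) ^ 2) +
          Real.sqrt (∑' k : Fin 2 → ℤ, (if (Y : ℤ) ≤ |k 0| ∧ (u' : ℤ) * |k 1| ≤ (v' : ℤ) * |k 0| then (1 : ℝ) else 0) *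
            ‖mFourierCoeff (fun x => (b j x : ℂ)) k‖ ^ 2)) ^ 2 +
        ((1 + P.γ) ^ (2 * (j + 1)) / Λb Mb) ^ 2) := by
  classical
  set Ψ : ShearProfile := amp ⟨P.U j, P.U_periodic j, P.contDiff_U (P.δ_pos hδ₀ hd j)⟩ P.γ with hΨ
  have hbs : IsSmooth (b j) := isSmooth_b P hδ₀ hd a b has hb j
  have hac : Continuous fun x => (a (j + 1) x : ℂ) := by
    rw [hab j]; exact Complex.continuous_ofReal.comp (hbs.continuous.comp (continuous_shearMap 1 0 _))
  set c : (Fin 2 → ℤ) → ℝ := fun k => ‖mFourierCoeff (fun x => (a (j + 1) x : ℂ)) k‖ ^ 2 with hc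
  have hcs : Summable c := (hasSum_sq_mFourierCoeff_of_continuous hac).summable
  have hc0 : ∀ k, 0 ≤ c k := fun k => sq_nonneg _
  have hI : ∀ (r : (Fin 2 → ℤ) → Prop) [DecidablePred r], Summable fun k => (if r k then (1 : ℝ) else 0) * c k := by
    intro r _
    refine Summable.of_nonneg_of_le (fun k => mul_nonneg (by split_ifs <;> norm_num) (hc0 k)) (fun k => ?_) hcs
    exact mul_le_of_le_one_left (hc0 k) (by split_ifs <;> norm_num)
  -- the split off the low fibres
  have hsplit : ∑' k : Fin 2 → ℤ, (if |k 0| < (K : ℤ) then (1 : ℝ) else 0) * c k ≤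
      ∑' k : Fin 2 → ℤ, (if |k 1| < (Λb 0 : ℤ) then (1 : ℝ) else 0) * c k +
        ∑' k : Fin 2 → ℤ, (if |k 0| < (K : ℤ) ∧ (Λb 0 : ℤ) ≤ |k 1| then (1 : ℝ) else 0) * c k := by
    rw [← (hI _).tsum_add (hI _)]
    refine (hI _).tsum_le_tsum (fun k => ?_) ((hI _).add (hI _))
    rw [← add_mul]
    exact mul_le_mul_of_nonneg_right (strip_indicator_le_low_add (K : ℤ) (Λb 0 : ℤ) (k 0) (k 1)) (hc0 k)
  refine hsplit.trans (add_le_add ?_ ?_)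
  · -- low fibres pass through the V half-step exactly
    exact le_of_eq (tsum_verticalWeight_vstep (a' := a (j + 1)) hbs.continuous Ψ (hab j)
      (w := fun m : ℤ => if |m| < (Λb 0 : ℤ) then (1 : ℝ) else 0) (C := 1) (fun m => by split_ifs <;> norm_num))
  -- the chopped fibres, block by block
  set p : ℕ → ℤ → ℕ := fun m _ => K + Q₂ m with hp
  set W : Finset (Fin 2 → ℤ) :=
    ((Finset.Icc (-(K : ℤ)) K ×ˢ Finset.Icc (-(Λb Mb : ℤ)) (Λb Mb)).filter
      (fun q : ℤ × ℤ => |q.1| < (K : ℤ) ∧ (Λb 0 : ℤ) ≤ |q.2| ∧ |q.2| < (Λb Mb : ℤ))).image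
      (fun q : ℤ × ℤ => (fun i : Fin 2 => if i = 0 then q.1 else q.2)) with hWdef
  have hWall : ∀ k ∈ W, |k 0| < (K : ℤ) ∧ (Λb 0 : ℤ) ≤ |k 1| ∧ |k 1| < (Λb Mb : ℤ) := by
    intro k hk
    obtain ⟨q, hq, rfl⟩ := Finset.mem_image.mp hk
    have h := (Finset.mem_filter.mp hq).2
    simpa using h
  have hqW : ∀ k : Fin 2 → ℤ, (|k 0| < (K : ℤ) ∧ (Λb 0 : ℤ) ≤ |k 1|) → |k 1| < (Λb Mb : ℤ) → k ∈ W := by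
    intro k hk h2
    refine Finset.mem_image.mpr ⟨(k 0, k 1), ?_, ?_⟩
    · refine Finset.mem_filter.mpr ⟨Finset.mem_product.mpr ⟨Finset.mem_Icc.mpr ?_, Finset.mem_Icc.mpr ?_⟩,
        hk.1, hk.2, h2⟩
      · exact ⟨by linarith [neg_abs_le (k 0), hk.1.le], by linarith [le_abs_self (k 0), hk.1.le]⟩
      · exact ⟨by linarith [neg_abs_le (k 1), h2.le], by linarith [le_abs_self (k 1), h2.le]⟩
    · funext i; fin_cases i <;> simp
  have hW : ∀ k ∈ W, (Λb 0 : ℤ) ≤ |k 1| ∧ |k 1| < (Λb Mb : ℤ) := fun k hk => ⟨(hWall k hk).2.1, (hWall k hk).2.2⟩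
  have hpG : ∀ m, ∀ k ∈ W, (Λb m : ℤ) ≤ |k 1| → |k 1| < (Λb (m + 1) : ℤ) → p m (k 1) < (k 1).natAbs * G :=
    fun m k _ h1 _ => stripPlateau_lt_shift (hΛQ m) h1
  have hWp : ∀ m, ∀ k ∈ W, (Λb m : ℤ) ≤ |k 1| → |k 1| < (Λb (m + 1) : ℤ) → |k 0| + Q₂ m ≤ (p m (k 1) : ℤ) := by
    intro m k hk _ _
    simp only [hp, Nat.cast_add]
    linarith [(hWall k hk).1]
  set A : ℕ → ℝ := fun m => (((K + Q₂ m : ℕ) : ℝ) + ((Λb m * G : ℕ) : ℝ)) /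
    (((Λb m * G : ℕ) : ℝ) - ((K + Q₂ m : ℕ) : ℝ)) with hA
  set Dm : ℕ → ℝ := fun m => ((Λb m * G : ℕ) : ℝ) - ((K + Q₂ m : ℕ) : ℝ) with hDm
  have hDm0 : ∀ m, 0 < Dm m := fun m => by
    have h : ((K + Q₂ m : ℕ) : ℝ) < ((Λb m * G : ℕ) : ℝ) := by exact_mod_cast hΛQ m
    show 0 < ((Λb m * G : ℕ) : ℝ) - ((K + Q₂ m : ℕ) : ℝ)
    linarith
  have hA0 : ∀ m, 0 ≤ A m := fun m => by
    have h1 : ((K + Q₂ m : ℕ) : ℝ) < ((Λb m * G : ℕ) : ℝ) := by exact_mod_cast hΛQ m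
    exact div_nonneg (by positivity) (by linarith)
  have hA' : ∀ m, ∀ k ∈ W, (Λb m : ℤ) ≤ |k 1| → |k 1| < (Λb (m + 1) : ℤ) →
      ((p m (k 1) : ℝ) + ((k 1).natAbs * G : ℕ)) / ((((k 1).natAbs * G : ℕ) : ℝ) - p m (k 1)) ≤ A m :=
    fun m k _ h1 _ => stripKernel_ratio_le (hΛQ m) h1
  have hD' : ∀ m, ∀ k ∈ W, (Λb m : ℤ) ≤ |k 1| → |k 1| < (Λb (m + 1) : ℤ) →
      Dm m ≤ (((k 1).natAbs * G : ℕ) : ℝ) - p m (k 1) := fun m k _ h1 _ => by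
    have h : Λb m ≤ (k 1).natAbs := by rw [← Int.natCast_natAbs] at h1; exact_mod_cast h1
    have h2 : ((Λb m * G : ℕ) : ℝ) ≤ (((k 1).natAbs * G : ℕ) : ℝ) := by exact_mod_cast Nat.mul_le_mul_right G h
    show ((Λb m * G : ℕ) : ℝ) - ((K + Q₂ m : ℕ) : ℝ) ≤ (((k 1).natAbs * G : ℕ) : ℝ) - ((K + Q₂ m : ℕ) : ℝ)
    linarith
  have hPf : ∀ m, ∀ k : Fin 2 → ℤ, (Λb m : ℤ) ≤ |k 1| → |k 1| < (Λb (m + 1) : ℤ) → (Q₁ m : ℤ) < |k 0| →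
      ((Y : ℤ) ≤ |k 0| ∧ (u' : ℤ) * |k 1| ≤ (v' : ℤ) * |k 0|) := by
    intro m k _ h2 h3
    have hf : ((u' * Λb (m + 1) : ℕ) : ℤ) ≤ ((v' * (Q₁ m + 1) : ℕ) : ℤ) := by exact_mod_cast hfeed m
    have hYm : ((Y : ℕ) : ℤ) ≤ ((Q₁ m + 1 : ℕ) : ℤ) := by exact_mod_cast hY m
    push_cast at hf hYm
    have h3' : (Q₁ m : ℤ) + 1 ≤ |k 0| := h3
    refine ⟨by linarith, ?_⟩
    have hu'0 : (0 : ℤ) ≤ u' := by positivity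
    have hv'0 : (0 : ℤ) ≤ v' := by positivity
    nlinarith [mul_le_mul_of_nonneg_left h2.le hu'0, mul_le_mul_of_nonneg_left h3' hv'0]
  exact tsum_class_vstep_blocks_osc_le P hγ hδ₀ hd hN₀ hρN a b has h0 hb hab j p _ Λb hΛb hΛ0 Mb W hqW hW hpG Q₁ Q₂ hQ
    hWp hM hMδ d₀ A Dm ε₀ hd₀ hMd hA0 hA' hDm0 hD' hAd hε0 hε _ hPf

/-! ## §2 (T-H): the low fibres of `b_j` -/

/-- **THE LOW FIBRES OF `b_j` THROUGH THE H HALF-STEP, SUMMED OVER FIBRE BLOCKS** (T-H; see the file header).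
[cite: Grafakos2014, Prop. 3.1.2 (5), Prop. 3.2.7 (3), §3.1.3] -/
theorem tsum_lowFibre_hstep_blocks_osc_le {G : ℕ} (hγ : P.γ = G) (hδ₀ : 0 < P.δ₀) (hd : 0 < P.d) (hN₀ : 1 ≤ P.N₀)
    (hρN : 1 ≤ P.ρN) (a b : ℕ → UnitAddTorus (Fin 2) → ℝ) (has : ∀ j, IsSmooth (a j)) (h0 : a 0 = datum)
    (hb : ∀ j, b j = a j ∘ shearMap 0 1 (amp ⟨P.U j, P.U_periodic j, P.contDiff_U (P.δ_pos hδ₀ hd j)⟩ P.γ))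
    (hab : ∀ j, a (j + 1) = b j ∘ shearMap 1 0 (amp ⟨P.U j, P.U_periodic j, P.contDiff_U (P.δ_pos hδ₀ hd j)⟩ P.γ))
    (j : ℕ) (K : ℕ) (Λb : ℕ → ℕ) (hΛb : Monotone Λb) (hΛ0 : 1 ≤ Λb 0) (Mb : ℕ)
    (Q₁ Q₂ : ℕ → ℕ) (hQ : ∀ m, Q₁ m < Q₂ m) (hΛQ : ∀ m, K + Q₂ m < Λb m * G)
    {M : ℝ} (hM : 1 ≤ M) (hMδ : M * P.δ j < π / 2)
    (d₀ ε₀ : ℕ → ℝ) (hd₀ : ∀ m, 0 < d₀ m) (hMd : ∀ m, M * P.δ j < π * P.N j * d₀ m)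
    (hAd : ∀ m, 1 / (2 * π * (((Λb m * G : ℕ) : ℝ) - ((K + Q₂ m : ℕ) : ℝ))) +
        4 * M * P.δ j / (π * (((Λb m * G : ℕ) : ℝ) - ((K + Q₂ m : ℕ) : ℝ)) * d₀ m) ≤
      (((K + Q₂ m : ℕ) : ℝ) + ((Λb m * G : ℕ) : ℝ)) / (((Λb m * G : ℕ) : ℝ) - ((K + Q₂ m : ℕ) : ℝ)) * d₀ m)
    (hε0 : ∀ m, 0 ≤ ε₀ m)
    (hε : ∀ m, (((K + Q₂ m : ℕ) : ℝ) + ((Λb m * G : ℕ) : ℝ)) / (((Λb m * G : ℕ) : ℝ) - ((K + Q₂ m : ℕ) : ℝ)) *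
      (2 * π * ((Λb (m + 1) * G : ℕ) : ℝ) * (Real.exp (-(M ^ 2 / 2)) / (2 * P.N j))) +
      2 * P.N j / (π * (((Λb m * G : ℕ) : ℝ) - ((K + Q₂ m : ℕ) : ℝ))) ≤ ε₀ m)
    {u' v' : ℕ} (hfeed : ∀ m, u' * Λb (m + 1) ≤ v' * (Q₁ m + 1)) :
    ∑' k : Fin 2 → ℤ, (if |k 1| < (K : ℤ) then (1 : ℝ) else 0) * ‖mFourierCoeff (fun x => (b j x : ℂ)) k‖ ^ 2 ≤
      ∑' k : Fin 2 → ℤ, (if |k 0| < (Λb 0 : ℤ) then (1 : ℝ) else 0) * ‖mFourierCoeff (fun x => (a j x : ℂ)) k‖ ^ 2 +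
      ((Real.sqrt (∑ m ∈ Finset.range Mb, ((((Q₁ m : ℝ) + Q₂ m) / ((Q₂ m : ℝ) - Q₁ m)) *
            (ε₀ m + (((K + Q₂ m : ℕ) : ℝ) + ((Λb m * G : ℕ) : ℝ)) / (((Λb m * G : ℕ) : ℝ) - ((K + Q₂ m : ℕ) : ℝ)) *
              Real.sqrt ((2 * P.N j : ℕ) * (4 * d₀ m)))) ^ 2) +
          Real.sqrt (∑' k : Fin 2 → ℤ, (if (Λb 0 : ℤ) ≤ |k 0| ∧ (u' : ℤ) * |k 0| ≤ (v' : ℤ) * |k 1| then (1 : ℝ) else 0) *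
            ‖mFourierCoeff (fun x => (a j x : ℂ)) k‖ ^ 2)) ^ 2 +
        ((1 + P.γ) ^ (2 * j) / Λb Mb) ^ 2) := by
  classical
  set Ψ : ShearProfile := amp ⟨P.U j, P.U_periodic j, P.contDiff_U (P.δ_pos hδ₀ hd j)⟩ P.γ with hΨ
  have hbs : IsSmooth (b j) := isSmooth_b P hδ₀ hd a b has hb j
  have hbc : Continuous fun x => (b j x : ℂ) := Complex.continuous_ofReal.comp hbs.continuous
  set c : (Fin 2 → ℤ) → ℝ := fun k => ‖mFourierCoeff (fun x => (b j x : ℂ)) k‖ ^ 2 with hc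
  have hcs : Summable c := (hasSum_sq_mFourierCoeff_of_continuous hbc).summable
  have hc0 : ∀ k, 0 ≤ c k := fun k => sq_nonneg _
  have hI : ∀ (r : (Fin 2 → ℤ) → Prop) [DecidablePred r], Summable fun k => (if r k then (1 : ℝ) else 0) * c k := by
    intro r _
    refine Summable.of_nonneg_of_le (fun k => mul_nonneg (by split_ifs <;> norm_num) (hc0 k)) (fun k => ?_) hcs
    exact mul_le_of_le_one_left (hc0 k) (by split_ifs <;> norm_num)
  have hsplit : ∑' k : Fin 2 → ℤ, (if |k 1| < (K : ℤ) then (1 : ℝ) else 0) * c k ≤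
      ∑' k : Fin 2 → ℤ, (if |k 0| < (Λb 0 : ℤ) then (1 : ℝ) else 0) * c k +
        ∑' k : Fin 2 → ℤ, (if |k 1| < (K : ℤ) ∧ (Λb 0 : ℤ) ≤ |k 0| then (1 : ℝ) else 0) * c k := by
    rw [← (hI _).tsum_add (hI _)]
    refine (hI _).tsum_le_tsum (fun k => ?_) ((hI _).add (hI _))
    rw [← add_mul]
    exact mul_le_mul_of_nonneg_right (strip_indicator_le_low_add (K : ℤ) (Λb 0 : ℤ) (k 1) (k 0)) (hc0 k)
  refine hsplit.trans (add_le_add ?_ ?_)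
  · -- low `k₀`-fibres pass through the H half-step exactly
    exact le_of_eq (tsum_horizontalWeight_hstep (b := b j) (has j).continuous Ψ (hb j)
      (w := fun m : ℤ => if |m| < (Λb 0 : ℤ) then (1 : ℝ) else 0) (C := 1) (fun m => by split_ifs <;> norm_num))
  set p : ℕ → ℤ → ℕ := fun m _ => K + Q₂ m with hp
  set W : Finset (Fin 2 → ℤ) :=
    ((Finset.Icc (-(Λb Mb : ℤ)) (Λb Mb) ×ˢ Finset.Icc (-(K : ℤ)) K).filter
      (fun q : ℤ × ℤ => |q.2| < (K : ℤ) ∧ (Λb 0 : ℤ) ≤ |q.1| ∧ |q.1| < (Λb Mb : ℤ))).image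
      (fun q : ℤ × ℤ => (fun i : Fin 2 => if i = 0 then q.1 else q.2)) with hWdef
  have hWall : ∀ k ∈ W, |k 1| < (K : ℤ) ∧ (Λb 0 : ℤ) ≤ |k 0| ∧ |k 0| < (Λb Mb : ℤ) := by
    intro k hk
    obtain ⟨q, hq, rfl⟩ := Finset.mem_image.mp hk
    have h := (Finset.mem_filter.mp hq).2
    simpa using h
  have hqW : ∀ k : Fin 2 → ℤ, (|k 1| < (K : ℤ) ∧ (Λb 0 : ℤ) ≤ |k 0|) → |k 0| < (Λb Mb : ℤ) → k ∈ W := by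
    intro k hk h2
    refine Finset.mem_image.mpr ⟨(k 0, k 1), ?_, ?_⟩
    · refine Finset.mem_filter.mpr ⟨Finset.mem_product.mpr ⟨Finset.mem_Icc.mpr ?_, Finset.mem_Icc.mpr ?_⟩,
        hk.1, hk.2, h2⟩
      · exact ⟨by linarith [neg_abs_le (k 0), h2.le], by linarith [le_abs_self (k 0), h2.le]⟩
      · exact ⟨by linarith [neg_abs_le (k 1), hk.1.le], by linarith [le_abs_self (k 1), hk.1.le]⟩
    · funext i; fin_cases i <;> simp
  have hW : ∀ k ∈ W, (Λb 0 : ℤ) ≤ |k 0| ∧ |k 0| < (Λb Mb : ℤ) := fun k hk => ⟨(hWall k hk).2.1, (hWall k hk).2.2⟩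
  have hpG : ∀ m, ∀ k ∈ W, (Λb m : ℤ) ≤ |k 0| → |k 0| < (Λb (m + 1) : ℤ) → p m (k 0) < (k 0).natAbs * G :=
    fun m k _ h1 _ => stripPlateau_lt_shift (hΛQ m) h1
  have hWp : ∀ m, ∀ k ∈ W, (Λb m : ℤ) ≤ |k 0| → |k 0| < (Λb (m + 1) : ℤ) → |k 1| + Q₂ m ≤ (p m (k 0) : ℤ) := by
    intro m k hk _ _
    simp only [hp, Nat.cast_add]
    linarith [(hWall k hk).1]
  set A : ℕ → ℝ := fun m => (((K + Q₂ m : ℕ) : ℝ) + ((Λb m * G : ℕ) : ℝ)) /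
    (((Λb m * G : ℕ) : ℝ) - ((K + Q₂ m : ℕ) : ℝ)) with hA
  set Dm : ℕ → ℝ := fun m => ((Λb m * G : ℕ) : ℝ) - ((K + Q₂ m : ℕ) : ℝ) with hDm
  have hDm0 : ∀ m, 0 < Dm m := fun m => by
    have h : ((K + Q₂ m : ℕ) : ℝ) < ((Λb m * G : ℕ) : ℝ) := by exact_mod_cast hΛQ m
    show 0 < ((Λb m * G : ℕ) : ℝ) - ((K + Q₂ m : ℕ) : ℝ)
    linarith
  have hA0 : ∀ m, 0 ≤ A m := fun m => by
    have h1 : ((K + Q₂ m : ℕ) : ℝ) < ((Λb m * G : ℕ) : ℝ) := by exact_mod_cast hΛQ m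
    exact div_nonneg (by positivity) (by linarith)
  have hA' : ∀ m, ∀ k ∈ W, (Λb m : ℤ) ≤ |k 0| → |k 0| < (Λb (m + 1) : ℤ) →
      ((p m (k 0) : ℝ) + ((k 0).natAbs * G : ℕ)) / ((((k 0).natAbs * G : ℕ) : ℝ) - p m (k 0)) ≤ A m :=
    fun m k _ h1 _ => stripKernel_ratio_le (hΛQ m) h1
  have hD' : ∀ m, ∀ k ∈ W, (Λb m : ℤ) ≤ |k 0| → |k 0| < (Λb (m + 1) : ℤ) →
      Dm m ≤ (((k 0).natAbs * G : ℕ) : ℝ) - p m (k 0) := fun m k _ h1 _ => by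
    have h : Λb m ≤ (k 0).natAbs := by rw [← Int.natCast_natAbs] at h1; exact_mod_cast h1
    have h2 : ((Λb m * G : ℕ) : ℝ) ≤ (((k 0).natAbs * G : ℕ) : ℝ) := by exact_mod_cast Nat.mul_le_mul_right G h
    show ((Λb m * G : ℕ) : ℝ) - ((K + Q₂ m : ℕ) : ℝ) ≤ (((k 0).natAbs * G : ℕ) : ℝ) - ((K + Q₂ m : ℕ) : ℝ)
    linarith
  have hPf : ∀ m, ∀ k : Fin 2 → ℤ, (Λb m : ℤ) ≤ |k 0| → |k 0| < (Λb (m + 1) : ℤ) → (Q₁ m : ℤ) < |k 1| →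
      ((Λb 0 : ℤ) ≤ |k 0| ∧ (u' : ℤ) * |k 0| ≤ (v' : ℤ) * |k 1|) := by
    intro m k h1 h2 h3
    have hf : ((u' * Λb (m + 1) : ℕ) : ℤ) ≤ ((v' * (Q₁ m + 1) : ℕ) : ℤ) := by exact_mod_cast hfeed m
    have hm0 : ((Λb 0 : ℕ) : ℤ) ≤ ((Λb m : ℕ) : ℤ) := by exact_mod_cast hΛb (Nat.zero_le m)
    push_cast at hf
    have h3' : (Q₁ m : ℤ) + 1 ≤ |k 1| := h3
    refine ⟨by linarith, ?_⟩
    have hu'0 : (0 : ℤ) ≤ u' := by positivity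
    have hv'0 : (0 : ℤ) ≤ v' := by positivity
    nlinarith [mul_le_mul_of_nonneg_left h2.le hu'0, mul_le_mul_of_nonneg_left h3' hv'0]
  exact tsum_class_hstep_blocks_osc_le P hγ hδ₀ hd hN₀ hρN a b has h0 hb hab j p _ Λb hΛb hΛ0 Mb W hqW hW hpG Q₁ Q₂ hQ
    hWp hM hMδ d₀ A Dm ε₀ hd₀ hMd hA0 hA' hDm0 hD' hAd hε0 hε _ hPf

end Cascade

end Summit.AnomalousDissipation.AnomalousDissipation.Theorems.SawtoothPulseCascade.K1Window
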